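import Summits.NavierStokesRegularity.FunctionalMining.RateBudgets
import Literature.Analysis.FunctionSpaces.TorusTestFunction
import Literature.Analysis.FunctionSpaces.TorusFourierConvolution
import HarnessLib

/-!
# Functional mining: the quadratic enstrophy budget reduces to a STATIC inequality on data

Search for candidate a priori estimates; no regularity claim.

Cell `pub-nsfunc` (host summit NavierStokesRegularity, topic `FunctionalMining`), NO-GO branch,
target `EnstrophyQuadraticBudget C` of `RateBudgets.lean` (census row C1: "`dℰ/dt ≤ (C/ν) ℰ²`
along every zero-mean classical solution of unforced Navier–Stokes on `T³`").

The dynamic reduction of `RateBudgets.lean` (`initialRate_le_of_isRateBudget`: local existence,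
the `H¹` balance at the initial time, uniqueness of one-sided derivatives) turns the budget into
`σ(u₀) − ν D(u₀) ≤ (C/ν) ℰ(u₀)²` at every smooth divergence-free zero-mean datum, where
`σ = enstrophyProduction = ∫⟪(u·∇)u, Δu⟫`, `D = ∫‖Δu‖²` (written out), `ℰ = torusEnstrophy`.
Running the datum along the AMPLITUDE ray `t • w` (`σ`, `D`, `ℰ²` are homogeneous of degrees
`3, 2, 4`) at `ν = 1` gives the viscosity-free STATIC form

  `t σ(w) ≤ D(w) + C t² ℰ(w)²` for all `t > 0`      (`EnstrophyQuadraticBudget.static`),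

i.e. (optimising in `t`) `σ(w)² ≤ 4 C ℰ(w)² D(w)` whenever `σ(w) > 0`
(`EnstrophyQuadraticBudget.sq_le`): the candidate is equivalent-in-strength to a bound on the
scale-invariant ratio `σ²/(ℰ² D)` (Navier–Stokes degrees `6 − 2 − 3 = 1`: NOT scale invariant
under concentration, hence expected unbounded — Sieve 1 of `Sieves.lean`). The no-go criterion
`not_enstrophyQuadraticBudget_of_unbounded` records the contrapositive: a family of smooth
divergence-free zero-mean fields with `σ > 0` along which `σ²/(ℰ² D)` is unbounded refutes
`EnstrophyQuadraticBudget C` for EVERY `C`. The concentrating family (planted bumps) is supplied by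
the companion files; the three-wave field of `ThreeWaveWitness.lean` alone gives the ratio
`1/(192 π²)` (so only `C < 1/(768π²)` is excluded by a fixed trigonometric polynomial).

This is the no-go seat's observation N2 ("critical budgets reduce to static functional
inequalities") made kernel-checked for row C1.
-/

noncomputable section

open MeasureTheory
open scoped RealInnerProductSpace

namespace Summit.NavierStokesRegularity.FunctionalMining

open Literature.Analysis.FunctionSpaces Literature.Analysis.FunctionSpaces.Torus
  Literature.Analysis.FluidPDE

variable {d : Type*} [Fintype d] [DecidableEq d]

/-! ## Homogeneity along amplitude rays (`σ`, `D = ∫‖Δv‖²`, `ℰ`) -/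

omit [DecidableEq d] in
/-- The Laplacian dissipation `D(v) = ∫_{T^d} ‖Δv‖²` (`= ‖∇ω‖₂²`, twice the palinstrophy, for
smooth divergence-free `v` on `T³`; minus the viscous rate of `ℰ`, `torusEnstrophy_hasInitialRate`)
is non-negative. It is written out as an integral throughout this file (no new definition).
[folklore] -/
theorem laplacianNormSq_nonneg (v : UnitAddTorus d → EuclideanSpace ℝ d) :
    0 ≤ ∫ x, ‖Torus.laplacian v x‖ ^ 2 :=
  integral_nonneg fun _ => sq_nonneg _

omit [DecidableEq d] in
/-- The convective term is quadratic along amplitude rays: `((c v)·∇)(c v) = c² (v·∇)v` for `C¹`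
fields. [folklore] -/
theorem convect_const_smul_self {v : UnitAddTorus d → EuclideanSpace ℝ d} (hv : IsContDiff 1 v)
    (c : ℝ) (x : UnitAddTorus d) :
    Torus.convect (c • v) (c • v) x = c ^ 2 • Torus.convect v v x := by
  simp only [Torus.convect, Torus.fderiv_const_smul hv c x, Pi.smul_apply, map_smul]
  rw [show (c • Torus.fderiv v x) (v x) = c • Torus.fderiv v x (v x) from rfl, smul_smul, sq]

omit [DecidableEq d] in
/-- The enstrophy production is cubic along amplitude rays: `σ(c v) = c³ σ(v)` for smooth `v`.
[folklore] -/
theorem enstrophyProduction_const_smul {v : UnitAddTorus d → EuclideanSpace ℝ d}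
    (hv : IsSmooth v) (c : ℝ) : enstrophyProduction (c • v) = c ^ 3 * enstrophyProduction v := by
  unfold enstrophyProduction
  rw [← integral_const_mul]
  refine integral_congr_ae (ae_of_all _ fun x => ?_)
  dsimp only
  rw [convect_const_smul_self (hv.isContDiff (by exact_mod_cast le_top)) c x,
    Torus.laplacian_const_smul_apply hv c x, real_inner_smul_left, real_inner_smul_right]
  ring

omit [DecidableEq d] in
/-- The Laplacian dissipation is quadratic along amplitude rays: `D(c v) = c² D(v)` for smooth
`v`. [folklore] -/
theorem laplacianNormSq_const_smul {v : UnitAddTorus d → EuclideanSpace ℝ d} (hv : IsSmooth v)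
    (c : ℝ) : (∫ x, ‖Torus.laplacian (c • v) x‖ ^ 2) = c ^ 2 * ∫ x, ‖Torus.laplacian v x‖ ^ 2 := by
  rw [← integral_const_mul]
  refine integral_congr_ae (ae_of_all _ fun x => ?_)
  dsimp only
  rw [Torus.laplacian_const_smul_apply hv c x, norm_smul, mul_pow, Real.norm_eq_abs, sq_abs]

/-- The enstrophy is quadratic along amplitude rays: `ℰ(c v) = c² ℰ(v)` for `C¹` fields.
[folklore] -/
theorem torusEnstrophy_const_smul {v : UnitAddTorus d → EuclideanSpace ℝ d} (hv : IsContDiff 1 v)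
    (c : ℝ) : torusEnstrophy (c • v) = c ^ 2 * torusEnstrophy v := by
  have h : Torus.gradNormSq (c • v) = c ^ 2 * Torus.gradNormSq v := by
    unfold Torus.gradNormSq
    rw [← integral_const_mul]
    refine integral_congr_ae (ae_of_all _ fun x => ?_)
    dsimp only
    rw [Finset.mul_sum]
    refine Finset.sum_congr rfl fun i _ => ?_
    rw [Torus.partialDeriv_const_smul hv c i, Pi.smul_apply, norm_smul, mul_pow, Real.norm_eq_abs,
      sq_abs]
  unfold torusEnstrophy
  rw [h]
  ring

/-- Incompressibility is preserved along amplitude rays (`C¹` fields). [folklore] -/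
theorem isDivFree_const_smul {v : UnitAddTorus d → EuclideanSpace ℝ d} (hv : IsContDiff 1 v)
    (hdiv : IsDivFree v) (c : ℝ) : IsDivFree (c • v) := by
  intro x
  have h : Torus.divergence (c • v) x = c * Torus.divergence v x := by
    unfold Torus.divergence
    rw [Finset.mul_sum]
    refine Finset.sum_congr rfl fun i _ => ?_
    have hvi : IsContDiff 1 (fun y => v y i) :=
      (EuclideanSpace.proj (𝕜 := ℝ) i : EuclideanSpace ℝ d →L[ℝ] ℝ).contDiff.comp hv
    have hfun : (fun y => (c • v) y i) = c • fun y => v y i := by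
      funext y; simp
    rw [hfun, Torus.partialDeriv_const_smul hvi c i]
    rfl
  rw [h, hdiv x, mul_zero]

omit [DecidableEq d] in
/-- Zero mean is preserved along amplitude rays. [folklore] -/
theorem hasZeroMean_const_smul {v : UnitAddTorus d → EuclideanSpace ℝ d} (hv : HasZeroMean v)
    (c : ℝ) : HasZeroMean (c • v) := by
  unfold HasZeroMean at hv ⊢
  simp [integral_smul, hv]

/-! ## The static form of the quadratic enstrophy budget -/

/-- **Static form of census row C1.** If `dℰ/dt ≤ (C/ν) ℰ²` held along every zero-mean classical
solution of unforced Navier–Stokes on `T³`, then at every smooth divergence-free zero-mean field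
`w` and for every `t > 0`:
`t · σ(w) ≤ D(w) + C t² ℰ(w)²`
(`σ = ∫⟪(w·∇)w, Δw⟫`, `D = ∫‖Δw‖²`, `ℰ = ½‖∇w‖₂²`). Proof: the dynamic reduction
`initialRate_le_of_isRateBudget` at the datum `t • w` with `ν = 1`, and homogeneity
(`σ, D, ℰ²` of degrees `3, 2, 4`), divided by `t²`. Search for candidate a priori estimates; no
regularity claim. [folklore] -/
theorem EnstrophyQuadraticBudget.static {C : ℝ} (hC : EnstrophyQuadraticBudget (d := d) C)
    (hd : Fintype.card d = 3) {w : UnitAddTorus d → EuclideanSpace ℝ d} (hw : IsSmooth w)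
    (hdiv : IsDivFree w) (hmean : HasZeroMean w) {t : ℝ} (ht : 0 < t) :
    t * enstrophyProduction w ≤
      (∫ x, ‖Torus.laplacian w x‖ ^ 2) + C * t ^ 2 * torusEnstrophy w ^ 2 := by
  have hw1 : IsContDiff 1 w := hw.isContDiff (by exact_mod_cast le_top)
  have h := initialRate_le_of_isRateBudget hC torusEnstrophy_hasInitialRate hd one_pos
    (hw.smul t) (isDivFree_const_smul hw1 hdiv t) (hasZeroMean_const_smul hmean t)
  rw [enstrophyProduction_const_smul hw t, torusEnstrophy_const_smul hw1 t, one_mul, div_one,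
    laplacianNormSq_const_smul hw t] at h
  -- `h : t³ σ + -(t² D) ≤ C (t² ℰ)²`; divide by `t² > 0`
  have ht2 : 0 < t ^ 2 := by positivity
  have key : t ^ 2 * (t * enstrophyProduction w) ≤
      t ^ 2 * ((∫ x, ‖Torus.laplacian w x‖ ^ 2) + C * t ^ 2 * torusEnstrophy w ^ 2) := by
    nlinarith [h]
  exact le_of_mul_le_mul_left key ht2

/-- **Optimised static form.** Under `EnstrophyQuadraticBudget C`, every smooth divergence-free
zero-mean field with positive production satisfies `σ(w)² ≤ 4 C ℰ(w)² D(w)` — a bound on the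
ratio `σ²/(ℰ² D)`, which has Navier–Stokes scaling degree `1` (not scale invariant). Cases: if
`C ℰ² ≤ 0` the static form gives `t σ ≤ D` for all `t`, absurd; else take `t = σ/(2Cℰ²)`.
[folklore] -/
theorem EnstrophyQuadraticBudget.sq_le {C : ℝ} (hC : EnstrophyQuadraticBudget (d := d) C)
    (hd : Fintype.card d = 3) {w : UnitAddTorus d → EuclideanSpace ℝ d} (hw : IsSmooth w)
    (hdiv : IsDivFree w) (hmean : HasZeroMean w) (hσ : 0 < enstrophyProduction w) :
    enstrophyProduction w ^ 2 ≤
      4 * C * torusEnstrophy w ^ 2 * ∫ x, ‖Torus.laplacian w x‖ ^ 2 := by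
  set σ := enstrophyProduction w with hσdef
  set D := ∫ x, ‖Torus.laplacian w x‖ ^ 2 with hDdef
  set E := torusEnstrophy w with hEdef
  have hD : 0 ≤ D := laplacianNormSq_nonneg w
  have hstat : ∀ t : ℝ, 0 < t → t * σ ≤ D + C * t ^ 2 * E ^ 2 := fun t ht =>
    hC.static hd hw hdiv hmean ht
  by_cases hCE : C * E ^ 2 ≤ 0
  · -- `t σ ≤ D` for all `t > 0`: impossible since `σ > 0`
    exfalso
    have h1 := hstat ((D + 1) / σ) (by positivity)
    have h2 : (D + 1) / σ * σ = D + 1 := div_mul_cancel₀ _ hσ.ne'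
    have h3 : C * ((D + 1) / σ) ^ 2 * E ^ 2 ≤ 0 := by
      have : 0 ≤ ((D + 1) / σ) ^ 2 := sq_nonneg _
      nlinarith
    linarith
  · push Not at hCE
    have h1 := hstat (σ / (2 * (C * E ^ 2))) (by positivity)
    -- `σ²/(2CE²) ≤ D + σ²/(4CE²)`, i.e. `2r ≤ D + r` with `r = σ²/(4CE²)`
    have hne : C * E ^ 2 ≠ 0 := hCE.ne'
    have h2 : σ / (2 * (C * E ^ 2)) * σ = 2 * (σ ^ 2 / (4 * (C * E ^ 2))) := by
      field_simp
      ring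
    have h3 : C * (σ / (2 * (C * E ^ 2))) ^ 2 * E ^ 2 = σ ^ 2 / (4 * (C * E ^ 2)) := by
      field_simp
      ring
    rw [h2, h3] at h1
    have h4 : σ ^ 2 / (4 * (C * E ^ 2)) ≤ D := by linarith
    rw [div_le_iff₀ (by positivity)] at h4
    linarith

/-- **No-go criterion for census row C1.** If along smooth divergence-free zero-mean fields on
`T³` with positive enstrophy production the scale-non-invariant ratio `σ²/(ℰ² D)` is unbounded
(for every `M` some field has `M ℰ² D < σ²`), then `EnstrophyQuadraticBudget C` fails for EVERY
real `C`: no constant makes `dℰ/dt ≤ (C/ν) ℰ²` a universal law on the 3-torus. A concentrating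
family (planted, rescaled bumps: `σ ↦ λ³σ`, `ℰ ↦ λℰ`, `D ↦ λ³D`, ratio `↦ λ·ratio`) realises the
hypothesis; it is supplied by the companion files. Search for candidate a priori estimates; no
regularity claim. [folklore] -/
theorem not_enstrophyQuadraticBudget_of_unbounded (hd : Fintype.card d = 3)
    (h : ∀ M : ℝ, ∃ w : UnitAddTorus d → EuclideanSpace ℝ d, IsSmooth w ∧ IsDivFree w ∧
      HasZeroMean w ∧ 0 < enstrophyProduction w ∧
      M * (torusEnstrophy w ^ 2 * ∫ x, ‖Torus.laplacian w x‖ ^ 2) < enstrophyProduction w ^ 2)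
    (C : ℝ) : ¬ EnstrophyQuadraticBudget (d := d) C := by
  intro hC
  obtain ⟨w, hw, hdiv, hmean, hσ, hM⟩ := h (4 * C)
  have := hC.sq_le hd hw hdiv hmean hσ
  linarith

/-- **Scaling form of the criterion.** It suffices to have ONE smooth divergence-free zero-mean
field `w₁` with `σ(w₁) > 0` embedded in a family `w n`, `n ≥ 1`, of smooth divergence-free
zero-mean fields obeying the concentration laws `σ(w n) = n³ σ(w₁)`, `ℰ(w n) = n ℰ(w₁)`,
`D(w n) = n³ D(w₁)` (the Navier–Stokes degrees `3, 1, 3` of Sieve 1): then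
`EnstrophyQuadraticBudget C` fails for every `C`. [folklore] -/
theorem not_enstrophyQuadraticBudget_of_scaling_family (hd : Fintype.card d = 3)
    {w₁ : UnitAddTorus d → EuclideanSpace ℝ d} (hσ₁ : 0 < enstrophyProduction w₁)
    (w : ℕ → UnitAddTorus d → EuclideanSpace ℝ d) (hw : ∀ n, 1 ≤ n → IsSmooth (w n))
    (hdiv : ∀ n, 1 ≤ n → IsDivFree (w n)) (hmean : ∀ n, 1 ≤ n → HasZeroMean (w n))
    (hσ : ∀ n, 1 ≤ n → enstrophyProduction (w n) = (n : ℝ) ^ 3 * enstrophyProduction w₁)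
    (hE : ∀ n, 1 ≤ n → torusEnstrophy (w n) = (n : ℝ) * torusEnstrophy w₁)
    (hD : ∀ n, 1 ≤ n → (∫ x, ‖Torus.laplacian (w n) x‖ ^ 2) =
      (n : ℝ) ^ 3 * ∫ x, ‖Torus.laplacian w₁ x‖ ^ 2) (C : ℝ) :
    ¬ EnstrophyQuadraticBudget (d := d) C := by
  refine not_enstrophyQuadraticBudget_of_unbounded hd (fun M => ?_) C
  set σ₁ := enstrophyProduction w₁
  set E₁ := torusEnstrophy w₁
  set D₁ := ∫ x, ‖Torus.laplacian w₁ x‖ ^ 2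
  have hD₁ : 0 ≤ D₁ := laplacianNormSq_nonneg w₁
  have hE₁ : 0 ≤ E₁ := torusEnstrophy_nonneg w₁
  -- choose `n` with `M E₁² D₁ < n σ₁²`
  obtain ⟨n, hn⟩ := exists_nat_gt (max 1 (M * (E₁ ^ 2 * D₁) / σ₁ ^ 2))
  have hn1 : 1 ≤ n := by
    have : (1 : ℝ) < n := lt_of_le_of_lt (le_max_left _ _) hn
    exact_mod_cast this.le
  have hnpos : (0 : ℝ) < n := by exact_mod_cast hn1
  have hM : M * (E₁ ^ 2 * D₁) < n * σ₁ ^ 2 := by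
    have h1 : M * (E₁ ^ 2 * D₁) / σ₁ ^ 2 < n := lt_of_le_of_lt (le_max_right _ _) hn
    rwa [div_lt_iff₀ (by positivity)] at h1
  refine ⟨w n, hw n hn1, hdiv n hn1, hmean n hn1, ?_, ?_⟩
  · rw [hσ n hn1]; positivity
  · rw [hσ n hn1, hE n hn1, hD n hn1]
    have hn8 : (0 : ℝ) < (n : ℝ) ^ 5 := by positivity
    calc M * (((n : ℝ) * E₁) ^ 2 * ((n : ℝ) ^ 3 * D₁))
        = (n : ℝ) ^ 5 * (M * (E₁ ^ 2 * D₁)) := by ring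
      _ < (n : ℝ) ^ 5 * (n * σ₁ ^ 2) := mul_lt_mul_of_pos_left hM hn8
      _ = ((n : ℝ) ^ 3 * σ₁) ^ 2 := by ring

end Summit.NavierStokesRegularity.FunctionalMining

end
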